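import Summits.ABC.ABC.Theorems.LogCardinalitySubPowerStewartYuRoutes
import HarnessLib

/-!
# Sub-power Stewart–Yu (crux `SubPowerStewartYu`, stmt-ABC-11053), V: the two cases of the cube

`Summits/ABC/ABC/Theorems/LogCardinalitySubPowerStewartYuCases.lean` — fifth helper file toward
`Summit.ABC.ABC.Theses.LogCardinality.SubPowerStewartYu`.

With `y = log c`, `Y = log max{e, 2y}`, `Λ = max(1, log R)`, `R = rad(abc)`, and for a member `w`
with prime set `S_w`: top `P_w = max(1, max S_w)`, tail `T_w = S_w ∖ {P_w}`,
junk `J_w = ∏_{T_w} 4K²(log q)²`, tail radical `r_w = ∏_{T_w} q` (so `R = ∏_w P_w r_w`):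

* `cube_slack_case` — **the slack case** (it contains the near-primorial regime of the crux's
  why-might-fail): if `J_a J_b J_c · E ≤ C³ · r_a r_b r_c` then `y³ ≤ 64 K⁹ C³ Λ⁶ Y³ R / E`
  (the three Pasten routes and the accounting with the slack kept; no inflation);
* `cube_top_case_a`, `cube_top_case_c` — **the top-heavy case**: if at the top prime `P` of `a`
  (resp. `c`) one has a bound `ν_P(w) log P ≤ Θ · Y · 3X` with `r_w ≤ X`, then
  `y³ ≤ 64 K⁹ C³ Λ⁶ Y³ R · (X / P)` (the case of `b` is that of `a` for the swapped triple);
[cite: StewartYu2001, Theorem 1 (proof scheme)] [cite: Stewart2013, Lemma 8 (arXiv pp. 9–10)].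
No new definitions.
-/

noncomputable section

-- `Summit.ABC.ABC.…` is the tree's namespace convention for this sub-problem (summit = problem).
set_option linter.dupNamespace false

open Finset Real Height
open Literature.NumberTheory.DiophantineGeometry
open Literature.NumberTheory.DiophantineGeometry.Dioph
open Literature.NumberTheory.DiophantineGeometry.Pasten
open Literature.Barriers.ABC

namespace Summit.ABC.ABC.Theorems.SubPowerSY

section Cases

variable {K : ℝ} {a b c : ℕ}

/-- Primes of a member are `≤ R`, hence their logarithms are `≤ Λ = max(1, log R)`. [folklore] -/
theorem log_le_max_log_rad (h : IsABCTriple a b c) {n : ℕ} (hn : n ∣ a * b * c) :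
    ∀ p ∈ n.primeFactors, Real.log p ≤ max 1 (Real.log (rad a b c : ℕ)) := by
  intro p hp
  obtain ⟨ha, hb, habc, hcop⟩ := id h
  have hc0 : 0 < c := by omega
  have habc0 : a * b * c ≠ 0 := by positivity
  have hp' := Nat.prime_of_mem_primeFactors hp
  have hpR : (p : ℝ) ≤ (rad a b c : ℝ) := by
    exact_mod_cast prime_le_rad hp' ((Nat.dvd_of_mem_primeFactors hp).trans hn) habc0
  have hp0 : (0 : ℝ) < p := by exact_mod_cast hp'.pos
  exact (Real.log_le_log hp0 hpR).trans (le_max_right _ _)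

/-- `R = (∏_{S_a} q)(∏_{S_b} q)(∏_{S_c} q)` as real numbers. [folklore] -/
theorem rad_eq_prod_three (h : IsABCTriple a b c) :
    ((rad a b c : ℕ) : ℝ) = (∏ p ∈ a.primeFactors, (p : ℝ)) *
      (∏ p ∈ b.primeFactors, (p : ℝ)) * ∏ p ∈ c.primeFactors, (p : ℝ) := by
  obtain ⟨ha, hb, habc, hcop⟩ := id h
  have hc : c ≠ 0 := by omega
  have hbc : b.Coprime c := coprime_right_of_isABCTriple h
  have hac : a.Coprime c := coprime_left_of_isABCTriple h
  rw [rad_def, Nat.radical_eq_prod_primeFactors, Nat.cast_prod,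
    prod_primeFactors_mul_of_coprime (mul_ne_zero ha.ne' hb.ne') hc (Nat.Coprime.mul_left hac hbc),
    prod_primeFactors_mul_of_coprime ha.ne' hb.ne' hcop]

/-- **The slack case of the cube.** If the junk factors are small against the tail radicals,
`(J_a J_b J_c) · E ≤ C³ (r_a r_b r_c)` with `E > 0`, then `y³ ≤ 64 K⁹ C³ Λ⁶ Y³ R / E`.
This is the regime of members with many small primes (near-primorial members): the accounting of
Stewart–Yu already saves the factor `E` there. [cite: StewartYu2001, Theorem 1 (proof scheme)] -/
theorem cube_slack_case (hK : 1 ≤ K) (hP : PastenApproximationBound K) {C E : ℝ}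
    (hE : 0 < E) (h : IsABCTriple a b c) (h1 : 1 < a * b)
    (hslack : (∏ p ∈ a.primeFactors.erase (max 1 (a.primeFactors.sup id)), (4 * K ^ 2 * Real.log p ^ 2)) *
        (∏ p ∈ b.primeFactors.erase (max 1 (b.primeFactors.sup id)), (4 * K ^ 2 * Real.log p ^ 2)) *
        (∏ p ∈ c.primeFactors.erase (max 1 (c.primeFactors.sup id)), (4 * K ^ 2 * Real.log p ^ 2)) * E ≤
      C ^ 3 * ((∏ p ∈ a.primeFactors.erase (max 1 (a.primeFactors.sup id)), (p : ℝ)) *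
        (∏ p ∈ b.primeFactors.erase (max 1 (b.primeFactors.sup id)), (p : ℝ)) *
        ∏ p ∈ c.primeFactors.erase (max 1 (c.primeFactors.sup id)), (p : ℝ))) :
    Real.log c ^ 3 ≤ 64 * K ^ 9 * C ^ 3 * max 1 (Real.log (rad a b c : ℕ)) ^ 6 *
      Real.log (max (Real.exp 1) (2 * Real.log c)) ^ 3 * (rad a b c : ℝ) / E := by
  obtain ⟨ha, hb, habc, hcop⟩ := id h
  have hc : c ≠ 0 := by omega
  have hbc : b.Coprime c := coprime_right_of_isABCTriple h
  have hac : a.Coprime c := coprime_left_of_isABCTriple h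
  have hy0 : 0 ≤ Real.log c := Real.log_nonneg (by exact_mod_cast Nat.one_le_iff_ne_zero.mpr hc)
  have hY0 : 0 ≤ Real.log (max (Real.exp 1) (2 * Real.log c)) :=
    zero_le_one.trans (one_le_log_max_exp _)
  set Λ := max 1 (Real.log (rad a b c : ℕ)) with hΛdef
  have hΛ1 : 1 ≤ Λ := le_max_left _ _
  have hK0 : 0 ≤ K := zero_le_one.trans hK
  -- the three routes
  have hA := log_lt_route_a hK hP h
  have hB := log_lt_route_b hK hP h
  have hCc := log_lt_route_c hK hP h h1
  rw [theta_zero_eq_split K hb.ne' hc hbc] at hA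
  rw [theta_zero_eq_split K ha.ne' hc hac] at hB
  rw [theta_zero_eq_split K ha.ne' hb.ne' hcop] at hCc
  -- accounting with slack for each member: `X = P_w`, `s = Σ_{S_w} q`
  have hprime : ∀ n : ℕ, ∀ p ∈ n.primeFactors, p.Prime := fun n p hp =>
    Nat.prime_of_mem_primeFactors hp
  have hacc : ∀ (n : ℕ), n ∣ a * b * c →
      K ^ (2 * n.primeFactors.card) * (∏ p ∈ n.primeFactors, Real.log p) ^ 2 *
        (1 + 3 * ∑ p ∈ n.primeFactors, (p : ℝ)) ≤
      4 * K ^ 2 * Λ ^ 2 * ((max 1 (n.primeFactors.sup id) : ℕ) : ℝ) *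
        ∏ p ∈ n.primeFactors.erase (max 1 (n.primeFactors.sup id)), (4 * K ^ 2 * Real.log p ^ 2) := by
    intro n hn
    exact member_accounting_gen hK hΛ1 n.primeFactors (hprime n) (log_le_max_log_rad h hn)
      (Nat.cast_nonneg _) (one_add_three_mul_sum_le_pow_mul_top n.primeFactors)
  have hXa := hacc a (Dvd.intro (b * c) (by ring))
  have hXb := hacc b (Dvd.intro (a * c) (by ring))
  have hXc := hacc c (Dvd.intro_left (a * b) rfl)
  have hsum0 : ∀ n : ℕ, 0 ≤ ∑ p ∈ n.primeFactors, ((p : ℕ) : ℝ) := fun n =>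
    Finset.sum_nonneg fun p _ => Nat.cast_nonneg p
  have key := cube_combine hK0 hy0 hY0 (hsum0 a) (hsum0 b) (hsum0 c) hA hB hCc hXa hXb hXc
  -- `R = ∏_w P_w r_w`
  have hpos1 : ∀ n : ℕ, ∀ q ∈ n.primeFactors, 1 ≤ q := fun n q hq =>
    (Nat.prime_of_mem_primeFactors hq).one_lt.le
  have hRa := prod_eq_top_mul_prod_erase a.primeFactors (hpos1 a)
  have hRb := prod_eq_top_mul_prod_erase b.primeFactors (hpos1 b)
  have hRc := prod_eq_top_mul_prod_erase c.primeFactors (hpos1 c)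
  have hR := rad_eq_prod_three h
  rw [hRa, hRb, hRc] at hR
  -- abbreviations
  set Pa : ℝ := ((max 1 (a.primeFactors.sup id) : ℕ) : ℝ)
  set Pb : ℝ := ((max 1 (b.primeFactors.sup id) : ℕ) : ℝ)
  set Pc : ℝ := ((max 1 (c.primeFactors.sup id) : ℕ) : ℝ)
  set Ja := ∏ p ∈ a.primeFactors.erase (max 1 (a.primeFactors.sup id)), (4 * K ^ 2 * Real.log p ^ 2)
  set Jb := ∏ p ∈ b.primeFactors.erase (max 1 (b.primeFactors.sup id)), (4 * K ^ 2 * Real.log p ^ 2)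
  set Jc := ∏ p ∈ c.primeFactors.erase (max 1 (c.primeFactors.sup id)), (4 * K ^ 2 * Real.log p ^ 2)
  set ra := ∏ p ∈ a.primeFactors.erase (max 1 (a.primeFactors.sup id)), (p : ℝ)
  set rb := ∏ p ∈ b.primeFactors.erase (max 1 (b.primeFactors.sup id)), (p : ℝ)
  set rc := ∏ p ∈ c.primeFactors.erase (max 1 (c.primeFactors.sup id)), (p : ℝ)
  set Y := Real.log (max (Real.exp 1) (2 * Real.log c))
  have hPabc0 : 0 ≤ Pa * Pb * Pc := by positivity
  have hJE : Pa * Pb * Pc * (Ja * Jb * Jc) ≤ Pa * Pb * Pc * (C ^ 3 * (ra * rb * rc) / E) := by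
    apply mul_le_mul_of_nonneg_left _ hPabc0
    rw [le_div_iff₀ hE]; exact hslack
  calc Real.log c ^ 3 ≤ K ^ 3 * Y ^ 3 * ((4 * K ^ 2 * Λ ^ 2 * Pa * Ja) * (4 * K ^ 2 * Λ ^ 2 * Pb * Jb) *
        (4 * K ^ 2 * Λ ^ 2 * Pc * Jc)) := key
    _ = 64 * K ^ 9 * Λ ^ 6 * Y ^ 3 * (Pa * Pb * Pc * (Ja * Jb * Jc)) := by ring
    _ ≤ 64 * K ^ 9 * Λ ^ 6 * Y ^ 3 * (Pa * Pb * Pc * (C ^ 3 * (ra * rb * rc) / E)) :=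
        mul_le_mul_of_nonneg_left hJE (by positivity)
    _ = 64 * K ^ 9 * C ^ 3 * Λ ^ 6 * Y ^ 3 * ((Pa * ra) * (Pb * rb) * (Pc * rc)) / E := by ring
    _ = 64 * K ^ 9 * C ^ 3 * Λ ^ 6 * Y ^ 3 * (rad a b c : ℝ) / E := by rw [hR]

/-- **The top-heavy case of the cube, top prime in `a`.** Let `P = max(1, max S_a) ∈ S_a` be the
top prime of `a`, `T = S_a ∖ {P}`. If `∏_T q ≤ X` and `ν_P(a) log P ≤ Θ_{bc} · Y · 3X`
(`Θ_{bc} = theta K b c 0`), then `y³ ≤ 64 K⁹ C³ Λ⁶ Y³ R · (X / P)`.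
[cite: StewartYu2001, Theorem 1 (proof scheme)] -/
theorem cube_top_case_a (hK : 1 ≤ K) (hP : PastenApproximationBound K) {C : ℝ} (hC1 : 1 ≤ C)
    (hC : ∀ S : Finset ℕ, (∀ p ∈ S, p.Prime) → ∏ p ∈ S, 4 * K ^ 2 * Real.log p ^ 2 / p ≤ C)
    (h : IsABCTriple a b c) (h1 : 1 < a * b) (hne : a.primeFactors.Nonempty) {X : ℝ}
    (hX : ∏ p ∈ a.primeFactors.erase (max 1 (a.primeFactors.sup id)), (p : ℝ) ≤ X)
    (htop : (a.factorization (max 1 (a.primeFactors.sup id)) : ℝ) *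
        Real.log ((max 1 (a.primeFactors.sup id) : ℕ) : ℝ) ≤
      theta K b c 0 * Real.log (max (Real.exp 1) (2 * Real.log c)) * (3 * X)) :
    Real.log c ^ 3 ≤ 64 * K ^ 9 * C ^ 3 * max 1 (Real.log (rad a b c : ℕ)) ^ 6 *
      Real.log (max (Real.exp 1) (2 * Real.log c)) ^ 3 * (rad a b c : ℝ) *
      (X / ((max 1 (a.primeFactors.sup id) : ℕ) : ℝ)) := by
  classical
  obtain ⟨ha, hb, habc, hcop⟩ := id h
  have hc : c ≠ 0 := by omega
  have hbc : b.Coprime c := coprime_right_of_isABCTriple h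
  have hac : a.Coprime c := coprime_left_of_isABCTriple h
  have hy0 : 0 ≤ Real.log c := Real.log_nonneg (by exact_mod_cast Nat.one_le_iff_ne_zero.mpr hc)
  have hY1 : 1 ≤ Real.log (max (Real.exp 1) (2 * Real.log c)) := one_le_log_max_exp _
  have hY0 : 0 ≤ Real.log (max (Real.exp 1) (2 * Real.log c)) := zero_le_one.trans hY1
  set Λ := max 1 (Real.log (rad a b c : ℕ)) with hΛdef
  have hΛ1 : 1 ≤ Λ := le_max_left _ _
  have hK0 : 0 ≤ K := zero_le_one.trans hK
  set P : ℕ := max 1 (a.primeFactors.sup id) with hPdef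
  set T := a.primeFactors.erase P with hTdef
  set Y := Real.log (max (Real.exp 1) (2 * Real.log c)) with hYdef
  have hpos1 : ∀ n : ℕ, ∀ q ∈ n.primeFactors, 1 ≤ q := fun n q hq =>
    (Nat.prime_of_mem_primeFactors hq).one_lt.le
  have hPS : P ∈ a.primeFactors := top_mem a.primeFactors hne (hpos1 a)
  have hprime : ∀ n : ℕ, ∀ p ∈ n.primeFactors, p.Prime := fun n p hp =>
    Nat.prime_of_mem_primeFactors hp
  have hTprime : ∀ q ∈ T, q.Prime := fun q hq => hprime a q (Finset.mem_of_mem_erase hq)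
  have hr1 : 1 ≤ ∏ p ∈ T, (p : ℝ) := Finset.one_le_prod fun q hq => by
    exact_mod_cast (hTprime q hq).one_lt.le
  have hX1 : 1 ≤ X := hr1.trans hX
  have hX0 : 0 ≤ X := zero_le_one.trans hX1
  -- route through `a` with the top prime bounded by `htop`
  have hA0 := log_lt_route_a_erase hK hP h hPS
  have hΘ0 : 0 ≤ theta K b c 0 := theta_nonneg hK0 b c 0
  have hA : Real.log c < theta K b c 0 * Y * (1 + 3 * (∑ p ∈ T, (p : ℝ) + X)) := by
    have : theta K b c 0 * Y * (1 + 3 * ∑ p ∈ T, (p : ℝ)) + theta K b c 0 * Y * (3 * X) =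
        theta K b c 0 * Y * (1 + 3 * (∑ p ∈ T, (p : ℝ) + X)) := by ring
    rw [← this]
    exact lt_of_lt_of_le hA0 (add_le_add le_rfl htop)
  have hB := log_lt_route_b hK hP h
  have hCc := log_lt_route_c hK hP h h1
  rw [theta_zero_eq_split K hb.ne' hc hbc] at hA
  rw [theta_zero_eq_split K ha.ne' hc hac] at hB
  rw [theta_zero_eq_split K ha.ne' hb.ne' hcop] at hCc
  -- accounting for `a` with `X`
  have hcardS : a.primeFactors.card = T.card + 1 := (Finset.card_erase_add_one hPS).symm
  have hsA : 1 + 3 * (∑ p ∈ T, (p : ℝ) + X) ≤ 4 ^ a.primeFactors.card * X := by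
    have h4 := one_add_three_mul_sum_le_pow_mul_prod T (fun q hq => hpos1 a q (Finset.mem_of_mem_erase hq))
    have h40 : (0 : ℝ) ≤ 4 ^ T.card := by positivity
    have h5 : (4 : ℝ) ^ T.card * ∏ p ∈ T, (p : ℝ) ≤ 4 ^ T.card * X := mul_le_mul_of_nonneg_left hX h40
    have h41 : (1 : ℝ) ≤ 4 ^ T.card := one_le_pow₀ (by norm_num)
    rw [hcardS, pow_succ]
    nlinarith
  have hXa0 := member_accounting_gen hK hΛ1 a.primeFactors (hprime a)
    (log_le_max_log_rad h (Dvd.intro (b * c) (by ring))) hX0 hsA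
  have hJa := prod_mul_log_sq_le_mul_prod hC T hTprime
  have hXa : K ^ (2 * a.primeFactors.card) * (∏ p ∈ a.primeFactors, Real.log p) ^ 2 *
      (1 + 3 * (∑ p ∈ T, (p : ℝ) + X)) ≤ 4 * K ^ 2 * Λ ^ 2 * X * (C * ∏ p ∈ T, (p : ℝ)) :=
    hXa0.trans (mul_le_mul_of_nonneg_left hJa (by positivity))
  -- classical accounting for `b`, `c`
  have hXb := member_accounting hK hC1 hC hΛ1 b.primeFactors (hprime b)
    (log_le_max_log_rad h (Dvd.intro (a * c) (by ring)))
  have hXc := member_accounting hK hC1 hC hΛ1 c.primeFactors (hprime c)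
    (log_le_max_log_rad h (Dvd.intro_left (a * b) rfl))
  have hsum0 : ∀ n : ℕ, 0 ≤ ∑ p ∈ n.primeFactors, ((p : ℕ) : ℝ) := fun n =>
    Finset.sum_nonneg fun p _ => Nat.cast_nonneg p
  have hsa0 : 0 ≤ ∑ p ∈ T, (p : ℝ) + X := add_nonneg (Finset.sum_nonneg fun p _ => Nat.cast_nonneg p) hX0
  have key := cube_combine hK0 hy0 hY0 hsa0 (hsum0 b) (hsum0 c) hA hB hCc hXa hXb hXc
  -- `R = P · r_a · rad b · rad c`
  have hRa : ∏ p ∈ a.primeFactors, (p : ℝ) = (P : ℝ) * ∏ p ∈ T, (p : ℝ) :=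
    (Finset.mul_prod_erase a.primeFactors (fun q => ((q : ℕ) : ℝ)) hPS).symm
  have hR := rad_eq_prod_three h
  rw [hRa] at hR
  have hP0 : (0 : ℝ) < P := by exact_mod_cast (hprime a P hPS).pos
  set ra := ∏ p ∈ T, (p : ℝ)
  set Rb := ∏ p ∈ b.primeFactors, (p : ℝ)
  set Rc := ∏ p ∈ c.primeFactors, (p : ℝ)
  calc Real.log c ^ 3 ≤ K ^ 3 * Y ^ 3 * ((4 * K ^ 2 * Λ ^ 2 * X * (C * ra)) *
        (4 * K ^ 2 * C * Λ ^ 2 * Rb) * (4 * K ^ 2 * C * Λ ^ 2 * Rc)) := key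
    _ = 64 * K ^ 9 * C ^ 3 * Λ ^ 6 * Y ^ 3 * ((P : ℝ) * ra * Rb * Rc) * (X / P) := by
        field_simp; ring
    _ = 64 * K ^ 9 * C ^ 3 * Λ ^ 6 * Y ^ 3 * (rad a b c : ℝ) * (X / P) := by rw [hR]

/-- **The top-heavy case of the cube, top prime in `c`.** As `cube_top_case_a`, with the bound
at the top prime `P` of `c` taken against `Θ_{ab} = theta K a b 0`.
[cite: StewartYu2001, Theorem 1 (proof scheme)] -/
theorem cube_top_case_c (hK : 1 ≤ K) (hP : PastenApproximationBound K) {C : ℝ} (hC1 : 1 ≤ C)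
    (hC : ∀ S : Finset ℕ, (∀ p ∈ S, p.Prime) → ∏ p ∈ S, 4 * K ^ 2 * Real.log p ^ 2 / p ≤ C)
    (h : IsABCTriple a b c) (h1 : 1 < a * b) (hne : c.primeFactors.Nonempty) {X : ℝ}
    (hX : ∏ p ∈ c.primeFactors.erase (max 1 (c.primeFactors.sup id)), (p : ℝ) ≤ X)
    (htop : (c.factorization (max 1 (c.primeFactors.sup id)) : ℝ) *
        Real.log ((max 1 (c.primeFactors.sup id) : ℕ) : ℝ) ≤
      theta K a b 0 * Real.log (max (Real.exp 1) (2 * Real.log c)) * (3 * X)) :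
    Real.log c ^ 3 ≤ 64 * K ^ 9 * C ^ 3 * max 1 (Real.log (rad a b c : ℕ)) ^ 6 *
      Real.log (max (Real.exp 1) (2 * Real.log c)) ^ 3 * (rad a b c : ℝ) *
      (X / ((max 1 (c.primeFactors.sup id) : ℕ) : ℝ)) := by
  classical
  obtain ⟨ha, hb, habc, hcop⟩ := id h
  have hc : c ≠ 0 := by omega
  have hbc : b.Coprime c := coprime_right_of_isABCTriple h
  have hac : a.Coprime c := coprime_left_of_isABCTriple h
  have hy0 : 0 ≤ Real.log c := Real.log_nonneg (by exact_mod_cast Nat.one_le_iff_ne_zero.mpr hc)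
  have hY1 : 1 ≤ Real.log (max (Real.exp 1) (2 * Real.log c)) := one_le_log_max_exp _
  have hY0 : 0 ≤ Real.log (max (Real.exp 1) (2 * Real.log c)) := zero_le_one.trans hY1
  set Λ := max 1 (Real.log (rad a b c : ℕ)) with hΛdef
  have hΛ1 : 1 ≤ Λ := le_max_left _ _
  have hK0 : 0 ≤ K := zero_le_one.trans hK
  set P : ℕ := max 1 (c.primeFactors.sup id) with hPdef
  set T := c.primeFactors.erase P with hTdef
  set Y := Real.log (max (Real.exp 1) (2 * Real.log c)) with hYdef
  have hpos1 : ∀ n : ℕ, ∀ q ∈ n.primeFactors, 1 ≤ q := fun n q hq =>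
    (Nat.prime_of_mem_primeFactors hq).one_lt.le
  have hPS : P ∈ c.primeFactors := top_mem c.primeFactors hne (hpos1 c)
  have hprime : ∀ n : ℕ, ∀ p ∈ n.primeFactors, p.Prime := fun n p hp =>
    Nat.prime_of_mem_primeFactors hp
  have hTprime : ∀ q ∈ T, q.Prime := fun q hq => hprime c q (Finset.mem_of_mem_erase hq)
  have hr1 : 1 ≤ ∏ p ∈ T, (p : ℝ) := Finset.one_le_prod fun q hq => by
    exact_mod_cast (hTprime q hq).one_lt.le
  have hX1 : 1 ≤ X := hr1.trans hX
  have hX0 : 0 ≤ X := zero_le_one.trans hX1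
  -- routes
  have hA := log_lt_route_a hK hP h
  have hB := log_lt_route_b hK hP h
  have hC0 := log_lt_route_c_erase hK hP h h1 hPS
  have hΘpos : 0 ≤ theta K a b 0 := theta_nonneg hK0 a b 0
  have hCc : Real.log c < theta K a b 0 * Y * (1 + 3 * (∑ p ∈ T, (p : ℝ) + X)) := by
    have : theta K a b 0 * Y * (1 + 3 * ∑ p ∈ T, (p : ℝ)) + theta K a b 0 * Y * (3 * X) =
        theta K a b 0 * Y * (1 + 3 * (∑ p ∈ T, (p : ℝ) + X)) := by ring
    rw [← this]
    exact lt_of_lt_of_le hC0 (add_le_add le_rfl htop)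
  rw [theta_zero_eq_split K hb.ne' hc hbc] at hA
  rw [theta_zero_eq_split K ha.ne' hc hac] at hB
  rw [theta_zero_eq_split K ha.ne' hb.ne' hcop] at hCc
  -- accounting for `c` with `X`
  have hcardS : c.primeFactors.card = T.card + 1 := (Finset.card_erase_add_one hPS).symm
  have hsC : 1 + 3 * (∑ p ∈ T, (p : ℝ) + X) ≤ 4 ^ c.primeFactors.card * X := by
    have h4 := one_add_three_mul_sum_le_pow_mul_prod T (fun q hq => hpos1 c q (Finset.mem_of_mem_erase hq))
    have h40 : (0 : ℝ) ≤ 4 ^ T.card := by positivity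
    have h5 : (4 : ℝ) ^ T.card * ∏ p ∈ T, (p : ℝ) ≤ 4 ^ T.card * X := mul_le_mul_of_nonneg_left hX h40
    have h41 : (1 : ℝ) ≤ 4 ^ T.card := one_le_pow₀ (by norm_num)
    rw [hcardS, pow_succ]
    nlinarith
  have hXc0 := member_accounting_gen hK hΛ1 c.primeFactors (hprime c)
    (log_le_max_log_rad h (Dvd.intro_left (a * b) rfl)) hX0 hsC
  have hJc := prod_mul_log_sq_le_mul_prod hC T hTprime
  have hXc : K ^ (2 * c.primeFactors.card) * (∏ p ∈ c.primeFactors, Real.log p) ^ 2 *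
      (1 + 3 * (∑ p ∈ T, (p : ℝ) + X)) ≤ 4 * K ^ 2 * Λ ^ 2 * X * (C * ∏ p ∈ T, (p : ℝ)) :=
    hXc0.trans (mul_le_mul_of_nonneg_left hJc (by positivity))
  -- classical accounting for `a`, `b`
  have hXa := member_accounting hK hC1 hC hΛ1 a.primeFactors (hprime a)
    (log_le_max_log_rad h (Dvd.intro (b * c) (by ring)))
  have hXb := member_accounting hK hC1 hC hΛ1 b.primeFactors (hprime b)
    (log_le_max_log_rad h (Dvd.intro (a * c) (by ring)))
  have hsum0 : ∀ n : ℕ, 0 ≤ ∑ p ∈ n.primeFactors, ((p : ℕ) : ℝ) := fun n =>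
    Finset.sum_nonneg fun p _ => Nat.cast_nonneg p
  have hsc0 : 0 ≤ ∑ p ∈ T, (p : ℝ) + X := add_nonneg (Finset.sum_nonneg fun p _ => Nat.cast_nonneg p) hX0
  have key := cube_combine hK0 hy0 hY0 (hsum0 a) (hsum0 b) hsc0 hA hB hCc hXa hXb hXc
  -- `R = rad a · rad b · P · r_c`
  have hRc : ∏ p ∈ c.primeFactors, (p : ℝ) = (P : ℝ) * ∏ p ∈ T, (p : ℝ) :=
    (Finset.mul_prod_erase c.primeFactors (fun q => ((q : ℕ) : ℝ)) hPS).symm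
  have hR := rad_eq_prod_three h
  rw [hRc] at hR
  have hP0 : (0 : ℝ) < P := by exact_mod_cast (hprime c P hPS).pos
  set rc := ∏ p ∈ T, (p : ℝ)
  set Ra := ∏ p ∈ a.primeFactors, (p : ℝ)
  set Rb := ∏ p ∈ b.primeFactors, (p : ℝ)
  calc Real.log c ^ 3 ≤ K ^ 3 * Y ^ 3 * ((4 * K ^ 2 * C * Λ ^ 2 * Ra) *
        (4 * K ^ 2 * C * Λ ^ 2 * Rb) * (4 * K ^ 2 * Λ ^ 2 * X * (C * rc))) := key
    _ = 64 * K ^ 9 * C ^ 3 * Λ ^ 6 * Y ^ 3 * (Ra * Rb * ((P : ℝ) * rc)) * (X / P) := by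
        field_simp; ring
    _ = 64 * K ^ 9 * C ^ 3 * Λ ^ 6 * Y ^ 3 * (rad a b c : ℝ) * (X / P) := by rw [hR]

end Cases


end Summit.ABC.ABC.Theorems.SubPowerSY

end
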